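/-
Copyright: lit-balaban Phase-2 proof seat p31.  Statement-level skeleton of a published paper; no proof claims beyond what the
kernel checks below.
-/
import Literature.MathematicalPhysics.QuantumFieldTheory.Balaban1983to89.LatticeFieldCalculus
import Literature.MathematicalPhysics.QuantumFieldTheory.BalabanImbrieJaffe1984to88.BIJ85Sect2SurfaceAverages

/-!
# `BalabanImbrieJaffe1984to88.BIJ85Eq219Proof` — T. Bałaban, J. Imbrie, A. Jaffe, *Renormalization of the Higgs model:
minimizers, propagators and the stability of mean field theory*, Commun. Math. Phys. **97** (1985) 299–329
[BalabanImbrieJaffe1985]: **(2.19)** `Q Q^{s*} = I` PROVED on the tori of the series, with the count `|B^s(b′)| = L^{d−1}`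
behind (2.18) discharged

statement-level skeleton of published theorems with citation tags; proofs where landed; nothing here is a claim about the Yang–Mills mass gap

PDF held: `paper:balaban1985-cmp97-bij-higgs-minimizers` (journal page = PDF page + 298).  Pages read as images:
`run/shared/lean/pub/pub-balaban/t4/b2b-balaban-t4-lit2/renders/bij1985/1985-cmp97-bij-higgs-minimizers-p005-x2.png` (p. 303),
`run/shared/lean/pub/lit-balaban/lit-balaban-r15/pages/1985-cmp97-bij-higgs-minimizers-p006-x2.png` (p. 304), `…-p007-x2.png` (p. 305).

CITATION HEADER (lean-in-tree rule).  Part of the lit-balaban TYPED SKELETON (HOME `run/shared/lean/pub/lit-balaban/`), Phase-2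
seat p31, row **C1.Eq2.19** of `HOME/SKELETON.md` (reader file `HOME/lit-balaban-r15/ROWS-C1.md`).  WHAT IS REPRODUCED, and how.
p. 305 [PDF 7], verbatim: *"Furthermore, by (2.13), QQ^{s*} = I. (2.19)"*, where (2.13) p. 304 is *"(QA)_{b′} = L^{−(d+1)}
Σ_{x∈B(b′₋)} Σ_{b∈Γ_{xx′}} A_b, (2.13) where Γ_{xx′} is the special contour from x to x′ and xx′ is the parallel transport of
the bond b′ to start at x"* (p. 303: *"we average over contours Γ_{xx′} which are translates of Γ_{yy′}"*, `Γ_{yy′} = b′` the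
straight L-lattice bond), and Q^{s*} is (2.17).  The two printed operators already live in the tree on DIFFERENT carriers:
Q = (2.13) is `…Balaban1983to89.LatticeFieldCalculus.bondAvg` (= [Balaban1984PropagatorsI] (1.11), the straight contours
`[x, x + Le_μ]` over the blocks of `Setup`), Q^{s*} = (2.17) is `BIJ85Sect2SurfaceAverages.BlockBonds.Qsstar` over the abstract
two-scale bond geometry `BlockBonds`.  This file BRIDGES them: `torusBlockBonds P j` is the `BlockBonds` geometry OF THE TORI
`T^{(j)} ⊃ T^{(j+1)}` of `Setup` (fine bonds `PBond P j`, coarse bonds `PBond P (j+1)`, block map `blockOf`; the two geometric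
fields `cbond_ext`/`cbond_ne` PROVED), and on it we PROVE
* the kernel geometry of (2.15): the straight contour of `c = ⟨y, y + e_μ⟩` issuing from `x = blockSite y r ∈ B(y)` contains
  EXACTLY ONE surface bond, its `(L−1−r_μ)`-th, which lies in `B^s(c)` and in no other surface set (`Qsstar_runBond`), and
  `B^s(⟨y, μ⟩) = {⟨blockSite y r, μ⟩ : r_μ = L − 1}` (`Bs_eq_map`);
* **(2.19)** `bondAvg (Q^{s*}B) = B` (`bondAvg_Qsstar`): `(QQ^{s*}B)(b′) = L^{−(d+1)}·L^d·(L·B(b′)) = B(b′)`;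
* the count `|B^s(b′)| = L^{d−1}` (`card_Bs`), so that (2.18) `Q^sQ^{s*} = L·I`, PROVED in `BIJ85Sect2SurfaceAverages` under
  that count as a hypothesis, now holds outright on the tori (`Qs_Qsstar_torus`); and
  the surface projection `P^s` is idempotent under that count on ANY two-scale geometry (`blockBonds_Ps_idem`), hence on the tori
  (`Ps_idem_torus`) — (2.18) *"Q^{s*}Q^s = LP^s … P^s the projection"* outright.
Companion `BIJ85Eq219ProofPart2`: the same identities for the uniform cell carrier `BIJ85CellAverages.Cells` (m = 1) and (2.19) for
the FULL linear average `LatticeFieldCalculus.fullBondAvg` ([Balaban1984PropagatorsI] (1.8); its staircase legs are interior bonds).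
Standing range `j + 1 ≤ m + K` of `Setup` throughout (hypothesis `hj`).  NOT here: the matrix form `B5Block118.QvOp` of (2.13) on
the carriers `Tor M × Fin d` (another carrier of the same operator; no bridge attempted), the k-fold identities (2.24).
Unit `lit-balaban-p31` (literature-prover-lit-balaban-p31-0), 2026-08-21.
-/

open scoped BigOperators

namespace Literature.MathematicalPhysics.QuantumFieldTheory.BalabanImbrieJaffe1984to88.BIJ85Eq219Proof

open Literature.MathematicalPhysics.QuantumFieldTheory.Balaban1983to89
open BIJ85Sect2SurfaceAverages LatticeFieldCalculus

variable {P : Params} {j : ℕ}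

/-! ## 1. Torus bookkeeping: bonds are determined by their endpoints; straight runs through the blocks -/

/-- A positively oriented bond has distinct endpoints (`1 ≠ 0` in `ZMod (2L^{m+K−k})`). [folklore] -/
private theorem src_ne_tgt {k : ℕ} (c : PBond P k) : c.src ≠ c.tgt := by
  intro h
  have h1 := congrFun h c.dir
  simp only [PBond.tgt, Site.shift, Function.update_self] at h1
  exact one_ne_zero (add_eq_left.1 h1.symm)

/-- The direction of a lattice step is determined by its effect. [folklore] -/
private theorem dir_eq_of_shift_eq {k : ℕ} (y : Site P k) {μ ν : Fin P.d} (h : y.shift μ = y.shift ν) : μ = ν := by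
  by_contra hne
  have h1 := congrFun h μ
  simp only [Site.shift, Function.update_self, Function.update_of_ne hne] at h1
  exact one_ne_zero (add_eq_left.1 h1)

/-- A positively oriented bond is determined by its ordered endpoints. [folklore] -/
private theorem pbond_ext {k : ℕ} {c c' : PBond P k} (hs : c.src = c'.src) (ht : c.tgt = c'.tgt) : c = c' := by
  have hd : c.dir = c'.dir := by
    apply dir_eq_of_shift_eq c.src
    have ht' : c.src.shift c.dir = c'.src.shift c'.dir := ht
    rw [← hs] at ht'
    exact ht'
  rcases c with ⟨s, μ⟩
  rcases c' with ⟨s', μ'⟩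
  simp only at hs hd
  subst hs
  subst hd
  rfl

/-- The sites of the straight contour `[x, x + Le_μ]` of (2.13) issuing from `x = blockSite y r ∈ B(y)`, first part: while
`r_μ + t < L` the site `x + te_μ` is the site of `B(y)` with offset `r_μ + t` in the direction `μ`.
[cite: BalabanImbrieJaffe1985, (2.13) p.304] -/
theorem runSite_blockSite_of_lt (y : Site P (j + 1)) (r : Fin P.d → Fin P.L) (μ : Fin P.d) {t : ℕ}
    (ht : (r μ : ℕ) + t < P.L) :
    runSite (Site.blockSite y r) μ t = Site.blockSite y (Function.update r μ ⟨r μ + t, ht⟩) := by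
  funext ν
  by_cases hν : ν = μ
  · subst hν
    simp only [runSite, Function.update_self, Site.blockSite]
    push_cast
    ring
  · simp only [runSite, Function.update_of_ne hν, Site.blockSite]

/-- The sites of the straight contour `[x, x + Le_μ]` of (2.13) issuing from `x = blockSite y r ∈ B(y)`, second part: once
`L ≤ r_μ + t (< 2L)` the site `x + te_μ` is the site of the NEXT block `B(y + e_μ)` with offset `r_μ + t − L` (standing range).
[cite: BalabanImbrieJaffe1985, (2.13) p.304] -/
theorem runSite_blockSite_of_ge (hj : j + 1 ≤ P.m + P.K) (y : Site P (j + 1)) (r : Fin P.d → Fin P.L) (μ : Fin P.d)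
    {t : ℕ} (h1 : P.L ≤ (r μ : ℕ) + t) (h2 : (r μ : ℕ) + t < 2 * P.L) :
    runSite (Site.blockSite y r) μ t =
      Site.blockSite (y.shift μ) (Function.update r μ ⟨r μ + t - P.L, by omega⟩) := by
  funext ν
  by_cases hν : ν = μ
  · subst hν
    simp only [runSite, Function.update_self, Site.blockSite, Site.shift]
    rw [AveragingRT.cast_succ_mul_L hj]
    have : (y ν).val * P.L + P.L + ((r ν : ℕ) + t - P.L) = (y ν).val * P.L + (r ν : ℕ) + t := by omega
    rw [this]
    push_cast
    ring
  · simp only [runSite, Function.update_of_ne hν, Site.blockSite, Site.shift]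

/-- Hence the block of `x + te_μ` is `B(y)` while `r_μ + t < L` … [cite: BalabanImbrieJaffe1985, (2.13) p.304] -/
theorem blockOf_runSite_blockSite_of_lt (hj : j + 1 ≤ P.m + P.K) (y : Site P (j + 1)) (r : Fin P.d → Fin P.L)
    (μ : Fin P.d) {t : ℕ} (ht : (r μ : ℕ) + t < P.L) : blockOf (runSite (Site.blockSite y r) μ t) = y := by
  rw [runSite_blockSite_of_lt y r μ ht, Site.blockOf_blockSite hj]

/-- … and `B(y + e_μ)` once `L ≤ r_μ + t < 2L`. [cite: BalabanImbrieJaffe1985, (2.13) p.304] -/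
theorem blockOf_runSite_blockSite_of_ge (hj : j + 1 ≤ P.m + P.K) (y : Site P (j + 1)) (r : Fin P.d → Fin P.L)
    (μ : Fin P.d) {t : ℕ} (h1 : P.L ≤ (r μ : ℕ) + t) (h2 : (r μ : ℕ) + t < 2 * P.L) :
    blockOf (runSite (Site.blockSite y r) μ t) = y.shift μ := by
  rw [runSite_blockSite_of_ge hj y r μ h1 h2, Site.blockOf_blockSite hj]

/-- Every fine site is a `blockSite` of its block (standing range; `Site.blockEquiv`). [folklore] -/
private theorem exists_eq_blockSite (hj : j + 1 ≤ P.m + P.K) (x : Site P j) :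
    ∃ r : Fin P.d → Fin P.L, x = Site.blockSite (blockOf x) r := by
  refine ⟨Site.blockEquiv hj (blockOf x) ⟨x, rfl⟩, ?_⟩
  have h := (Site.blockEquiv hj (blockOf x)).symm_apply_apply ⟨x, rfl⟩
  exact (congrArg Subtype.val h).symm

/-- The far endpoint of a fine bond lies in the block of its near endpoint or in the next block in the bond's direction
(standing range). [cite: BalabanImbrieJaffe1985, (2.15) p.304] -/
theorem blockOf_tgt (hj : j + 1 ≤ P.m + P.K) (b : PBond P j) :
    blockOf b.tgt = blockOf b.src ∨ blockOf b.tgt = (blockOf b.src).shift b.dir := by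
  obtain ⟨r, hr⟩ := exists_eq_blockSite hj b.src
  have htgt : b.tgt = runSite (Site.blockSite (blockOf b.src) r) b.dir 1 := by
    rw [PBond.tgt, hr, Site.blockOf_blockSite hj, runSite_succ, runSite_zero]
  by_cases hlt : (r b.dir : ℕ) + 1 < P.L
  · left
    rw [htgt, blockOf_runSite_blockSite_of_lt hj _ r _ hlt]
  · right
    have := (r b.dir).isLt
    rw [htgt, blockOf_runSite_blockSite_of_ge hj _ r _ (by omega) (by omega)]

/-! ## 2. The two-scale bond geometry (2.15) of the tori -/

/-- BIJ's two-scale bond geometry of Sect. 2 (fine bonds with endpoints, coarse bonds with endpoints, the block map `x ↦ y` with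
`x ∈ B(y)`, `L`, `d`) INSTANTIATED BY THE TORI of the series: fine lattice `T^{(j)}` (`Site P j`, bonds `PBond P j`), coarse
lattice `T^{(j+1)}`, block map `blockOf` of `Setup` (centred blocks; (2.13)–(2.19) are translation covariant, the anchor is
immaterial), block size `P.L`, dimension `P.d`; the two geometric facts carried by `BlockBonds` — a coarse bond is determined by its
ordered endpoints and has distinct endpoints — PROVED (`1 ≠ 0` in `ZMod (2L^{m+K−j−1})`).  *"Define the set of surface bonds
B^s(b′) for an L-lattice bond b′ as follows: B^s(b′) = {b : b = (b₋, b₊), b₋ ∈ B(b′₋), b₊ ∈ B(b′₊)} (2.15)"*.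
[cite: BalabanImbrieJaffe1985, (2.15) p.304] -/
@[reducible] noncomputable def torusBlockBonds (P : Params) (j : ℕ) : BlockBonds where
  X := Site P j
  Y := Site P (j + 1)
  FB := PBond P j
  CB := PBond P (j + 1)
  fbFintype := inferInstance
  cbFintype := inferInstance
  fbDecEq := Classical.decEq _
  yDecEq := inferInstance
  src := PBond.src
  tgt := PBond.tgt
  csrc := PBond.src
  ctgt := PBond.tgt
  blk := blockOf
  L := P.L
  d := P.d
  one_le_L := by have := P.hL.2; omega
  one_le_d := P.hd
  cbond_ext := fun _ _ hs ht => pbond_ext hs ht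
  cbond_ne := fun c => src_ne_tgt c

/-- kernel: membership in `B^s(c)` on the tori, in the vocabulary of `Setup`: `b₋ ∈ B(c₋)` and `b₊ ∈ B(c₊)`.
[cite: BalabanImbrieJaffe1985, (2.15) p.304] -/
theorem mem_Bs_iff (c : PBond P (j + 1)) (b : PBond P j) :
    b ∈ (torusBlockBonds P j).Bs c ↔ blockOf b.src = c.src ∧ blockOf b.tgt = c.tgt :=
  (torusBlockBonds P j).mem_Bs c b

/-- kernel geometry of (2.15)/(2.13): the `t`-th bond of the straight contour of `c = ⟨y, y + e_μ⟩` issuing from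
`x = blockSite y r ∈ B(y)` IS a surface bond of `c` when `r_μ + t + 1 = L` (its endpoints lie in `B(y)` and `B(y + e_μ)`).
[cite: BalabanImbrieJaffe1985, (2.15) p.304] -/
theorem runBond_mem_Bs (hj : j + 1 ≤ P.m + P.K) (y : Site P (j + 1)) (r : Fin P.d → Fin P.L) (μ : Fin P.d) {t : ℕ}
    (ht : (r μ : ℕ) + t + 1 = P.L) : runBond (Site.blockSite y r) μ t ∈ (torusBlockBonds P j).Bs ⟨y, μ⟩ := by
  rw [mem_Bs_iff]
  constructor
  · show blockOf (runSite (Site.blockSite y r) μ t) = y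
    exact blockOf_runSite_blockSite_of_lt hj y r μ (by omega)
  · show blockOf ((runSite (Site.blockSite y r) μ t).shift μ) = y.shift μ
    rw [← runSite_succ]
    exact blockOf_runSite_blockSite_of_ge hj y r μ (by omega) (by omega)

/-- kernel geometry of (2.15)/(2.13): every OTHER bond of that straight contour (`t < L`, `r_μ + t + 1 ≠ L`) is an interior bond
— both endpoints in `B(y)` or both in `B(y + e_μ)` — hence lies in no surface set. [cite: BalabanImbrieJaffe1985, (2.15) p.304] -/
theorem runBond_not_mem_Bs (hj : j + 1 ≤ P.m + P.K) (y : Site P (j + 1)) (r : Fin P.d → Fin P.L) (μ : Fin P.d) {t : ℕ}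
    (htL : t < P.L) (ht : (r μ : ℕ) + t + 1 ≠ P.L) (c : PBond P (j + 1)) :
    runBond (Site.blockSite y r) μ t ∉ (torusBlockBonds P j).Bs c := by
  rw [mem_Bs_iff]
  rintro ⟨h1, h2⟩
  change blockOf (runSite (Site.blockSite y r) μ t) = c.src at h1
  change blockOf ((runSite (Site.blockSite y r) μ t).shift μ) = c.tgt at h2
  rw [← runSite_succ] at h2
  have hr := (r μ).isLt
  by_cases hlt : (r μ : ℕ) + t + 1 < P.L
  · rw [blockOf_runSite_blockSite_of_lt hj y r μ (t := t) (by omega)] at h1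
    rw [blockOf_runSite_blockSite_of_lt hj y r μ (t := t + 1) (by omega)] at h2
    exact src_ne_tgt c (h1.symm.trans h2)
  · rw [blockOf_runSite_blockSite_of_ge hj y r μ (t := t) (by omega) (by omega)] at h1
    rw [blockOf_runSite_blockSite_of_ge hj y r μ (t := t + 1) (by omega) (by omega)] at h2
    exact src_ne_tgt c (h1.symm.trans h2)

/-! ## 3. (2.19) `Q Q^{s*} = I` for Q = (2.13) (`bondAvg`) -/

/-- kernel: the values of `Q^{s*}B` ((2.17): *"(Q^{s*}A)_b = LA_{b′} if b ∈ B^s(b′), 0 otherwise"*) along the straight contour of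
`c = ⟨y, y + e_μ⟩` issuing from `blockSite y r`: `L·B(c)` at the bond crossing the two blocks, `0` at the `L − 1` interior bonds.
[cite: BalabanImbrieJaffe1985, (2.17) p.304] -/
theorem Qsstar_runBond (hj : j + 1 ≤ P.m + P.K) (B : PBond P (j + 1) → ℝ) (y : Site P (j + 1)) (r : Fin P.d → Fin P.L)
    (μ : Fin P.d) {t : ℕ} (htL : t < P.L) :
    (torusBlockBonds P j).Qsstar B (runBond (Site.blockSite y r) μ t)
      = if (r μ : ℕ) + t + 1 = P.L then (P.L : ℝ) * B ⟨y, μ⟩ else 0 := by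
  split_ifs with h
  · exact (torusBlockBonds P j).Qsstar_of_mem B (runBond_mem_Bs hj y r μ h)
  · exact (torusBlockBonds P j).Qsstar_of_not_mem B (fun c => runBond_not_mem_Bs hj y r μ htL h c)

/-- kernel: the inner sum of (2.13) applied to `Q^{s*}B`: `Σ_{b∈Γ_{xx′}} (Q^{s*}B)_b = L·B(b′)` for every `x ∈ B(b′₋)` (exactly one
surface bond on each contour). [cite: BalabanImbrieJaffe1985, (2.19) p.305] -/
theorem segSum_Qsstar (hj : j + 1 ≤ P.m + P.K) (B : PBond P (j + 1) → ℝ) (y : Site P (j + 1)) (r : Fin P.d → Fin P.L)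
    (μ : Fin P.d) :
    segSum (V := ℝ) ((torusBlockBonds P j).Qsstar B) (Site.blockSite y r) μ P.L = (P.L : ℝ) * B ⟨y, μ⟩ := by
  have hr := (r μ).isLt
  unfold segSum
  rw [Finset.sum_eq_single_of_mem (P.L - 1 - (r μ : ℕ)) (Finset.mem_range.mpr (by omega))]
  · show (torusBlockBonds P j).Qsstar B (runBond (Site.blockSite y r) μ (P.L - 1 - (r μ : ℕ))) = _
    rw [Qsstar_runBond hj B y r μ (by omega), if_pos (by omega)]
  · intro t ht hne
    show (torusBlockBonds P j).Qsstar B (runBond (Site.blockSite y r) μ t) = 0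
    rw [Qsstar_runBond hj B y r μ (Finset.mem_range.mp ht), if_neg]
    intro h
    exact hne (by omega)

/-- **(2.19)** p. 305 [PDF 7], verbatim: *"Furthermore, by (2.13), QQ^{s*} = I. (2.19)"* — PROVED on the tori of the series
(standing range `j + 1 ≤ m + K`) for Q = (2.13) = `LatticeFieldCalculus.bondAvg` (the straight contours `Γ_{xx′}`, translates of
`b′`) and Q^{s*} = (2.17) = `BlockBonds.Qsstar` of the torus geometry `torusBlockBonds`: `(QQ^{s*}B)(b′) = L^{−(d+1)} Σ_{x∈B(b′₋)}
L·B(b′) = B(b′)`. [cite: BalabanImbrieJaffe1985, (2.19) p.305] -/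
theorem bondAvg_Qsstar (hj : j + 1 ≤ P.m + P.K) (B : PBond P (j + 1) → ℝ) :
    bondAvg (V := ℝ) ((torusBlockBonds P j).Qsstar B) = B := by
  funext c
  have hL : (P.L : ℝ) ≠ 0 := Nat.cast_ne_zero.mpr P.L_pos.ne'
  have hc : (⟨c.src, c.dir⟩ : PBond P (j + 1)) = c := rfl
  unfold bondAvg
  simp_rw [segSum_Qsstar hj B, hc]
  rw [Finset.sum_const, Finset.card_univ, Fintype.card_fun, Fintype.card_fin, Fintype.card_fin,
    ← Nat.cast_smul_eq_nsmul ℝ, smul_smul, smul_eq_mul]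
  rw [Nat.cast_pow, pow_succ]
  field_simp

/-! ## 4. The count `|B^s(b′)| = L^{d−1}` and (2.18) outright -/

/-- kernel: `r ↦ ⟨blockSite y r, μ⟩` is injective (standing range) — the bonds of a face of `B(y)` as an embedded copy of
the offsets. [cite: BalabanImbrieJaffe1985, (2.15) p.304] -/
def blockBondEmb (hj : j + 1 ≤ P.m + P.K) (y : Site P (j + 1)) (μ : Fin P.d) : (Fin P.d → Fin P.L) ↪ PBond P j :=
  ⟨fun r => ⟨Site.blockSite y r, μ⟩, fun _ _ h => (AveragingRT.blockSite_inj hj (PBond.mk.inj h).1).2⟩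

/-- kernel geometry of (2.15): on the tori the surface set of `b′ = ⟨y, y + e_μ⟩` consists exactly of the bonds `⟨blockSite y r, μ⟩`
with offset `r_μ = L − 1` (the face of `B(y)` towards `B(y + e_μ)`), the other offsets free. [cite: BalabanImbrieJaffe1985, (2.15) p.304] -/
theorem Bs_eq_map (hj : j + 1 ≤ P.m + P.K) (y : Site P (j + 1)) (μ : Fin P.d) :
    (torusBlockBonds P j).Bs ⟨y, μ⟩ =
      (Fintype.piFinset fun ν => if ν = μ then {(⟨P.L - 1, by have := P.hL.2; omega⟩ : Fin P.L)} else Finset.univ).map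
        (blockBondEmb hj y μ) := by
  ext b
  rw [mem_Bs_iff, Finset.mem_map]
  constructor
  · rintro ⟨h1, h2⟩
    obtain ⟨r, hr⟩ := exists_eq_blockSite hj b.src
    rw [h1] at hr
    have hL := P.hL.2
    have hrμ := (r b.dir).isLt
    -- the far endpoint `b₊ = b₋ + e_{dir}` must leave the block: `r_{dir} = L - 1`, and then `dir = μ`
    have htgt : b.tgt = runSite (Site.blockSite y r) b.dir 1 := by
      rw [PBond.tgt, hr, runSite_succ, runSite_zero]
    have hlast : (r b.dir : ℕ) + 1 = P.L := by
      by_contra hne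
      rw [htgt, blockOf_runSite_blockSite_of_lt hj y r b.dir (by omega)] at h2
      exact src_ne_tgt ⟨y, μ⟩ h2
    have hdir : b.dir = μ := by
      rw [htgt, blockOf_runSite_blockSite_of_ge hj y r b.dir (by omega) (by omega)] at h2
      exact dir_eq_of_shift_eq y h2
    refine ⟨r, Fintype.mem_piFinset.mpr fun ν => ?_, ?_⟩
    · by_cases hν : ν = μ
      · subst hν
        rw [if_pos rfl, Finset.mem_singleton]
        exact Fin.ext (by rw [← hdir]; simp only; omega)
      · rw [if_neg hν]
        exact Finset.mem_univ _
    · rcases b with ⟨s, ν⟩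
      simp only at hr hdir
      show (⟨Site.blockSite y r, μ⟩ : PBond P j) = ⟨s, ν⟩
      rw [hr, hdir]
  · rintro ⟨r, hr, rfl⟩
    show blockOf (Site.blockSite y r) = y ∧ blockOf (PBond.tgt ⟨Site.blockSite y r, μ⟩) = PBond.tgt ⟨y, μ⟩
    have hrμ : (r μ : ℕ) = P.L - 1 := by
      have := Fintype.mem_piFinset.mp hr μ
      rw [if_pos rfl, Finset.mem_singleton] at this
      exact congrArg Fin.val this
    have hL := P.hL.2
    have hmem := runBond_mem_Bs hj y r μ (t := 0) (by omega)
    rw [mem_Bs_iff] at hmem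
    simpa [runBond, runSite_zero] using hmem

/-- The printed count behind (2.18): *an L-cube face has L^{d−1} surface bonds* — `|B^s(b′)| = L^{d−1}` on the tori (standing
range). [cite: BalabanImbrieJaffe1985, (2.18) p.304] -/
theorem card_Bs (hj : j + 1 ≤ P.m + P.K) (c : PBond P (j + 1)) : ((torusBlockBonds P j).Bs c).card = P.L ^ (P.d - 1) := by
  obtain ⟨y, μ⟩ := c
  rw [Bs_eq_map hj y μ, Finset.card_map, Fintype.card_piFinset,
    ← Finset.mul_prod_erase Finset.univ _ (Finset.mem_univ μ), if_pos rfl, Finset.card_singleton, one_mul,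
    Finset.prod_congr rfl fun ν hν => by rw [if_neg (Finset.ne_of_mem_erase hν), Finset.card_univ, Fintype.card_fin],
    Finset.prod_const, Finset.card_erase_of_mem (Finset.mem_univ μ), Finset.card_univ, Fintype.card_fin]

/-- **(2.18)** p. 304 [PDF 6], first identity, *"Q^sQ^{s*} = LI"* — now OUTRIGHT on the tori of the series (the count hypothesis
`hcard` of `BlockBonds.Qs_Qsstar` discharged by `card_Bs`). [cite: BalabanImbrieJaffe1985, (2.18) p.304] -/
theorem Qs_Qsstar_torus (hj : j + 1 ≤ P.m + P.K) (B : PBond P (j + 1) → ℝ) (c : PBond P (j + 1)) :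
    (torusBlockBonds P j).Qs ((torusBlockBonds P j).Qsstar B) c = (P.L : ℝ) * B c :=
  (torusBlockBonds P j).Qs_Qsstar (card_Bs hj) B c

/-- kernel: the value of the surface projection `P^s` of (2.18) on a surface bond `b ∈ B^s(b′)`: the average of `A` over
`B^s(b′)` (any two-scale bond geometry). [cite: BalabanImbrieJaffe1985, (2.18) p.304] -/
theorem blockBonds_Ps_of_mem (G : BlockBonds) (A : G.FB → ℝ) {b : G.FB} {c : G.CB} (h : b ∈ G.Bs c) :
    G.Ps A b = ((G.L : ℝ) ^ (G.d - 1))⁻¹ * ∑ b' ∈ G.Bs c, A b' := by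
  classical
  unfold BlockBonds.Ps
  rw [Finset.sum_eq_single c]
  · simp [h]
  · intro c' _ hne
    have : b ∉ G.Bs c' := fun h' => hne (G.Bs_unique h' h)
    simp [this]
  · intro hc
    exact absurd (Finset.mem_univ c) hc

/-- kernel: `P^s` of (2.18) vanishes on interior bonds (*"zero on interior bonds"*; any two-scale bond geometry).
[cite: BalabanImbrieJaffe1985, (2.18) p.304] -/
theorem blockBonds_Ps_of_not_mem (G : BlockBonds) (A : G.FB → ℝ) {b : G.FB} (h : ∀ c, b ∉ G.Bs c) : G.Ps A b = 0 := by
  unfold BlockBonds.Ps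
  exact Finset.sum_eq_zero fun c _ => by simp [h c]

/-- kernel: `P^s` of (2.18) is idempotent under the printed count `|B^s(b′)| = L^{d−1}` (any two-scale bond geometry; it is
*"the projection onto configurations which are constant on surface bonds and zero on interior bonds"*).
[cite: BalabanImbrieJaffe1985, (2.18) p.304] -/
theorem blockBonds_Ps_idem (G : BlockBonds) (hcard : ∀ c : G.CB, (G.Bs c).card = G.L ^ (G.d - 1)) (A : G.FB → ℝ)
    (b : G.FB) : G.Ps (G.Ps A) b = G.Ps A b := by
  classical
  have hpowne : ((G.L : ℝ) ^ (G.d - 1)) ≠ 0 := by have := G.one_le_L; positivity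
  by_cases hb : ∃ c, b ∈ G.Bs c
  · obtain ⟨c, hc⟩ := hb
    rw [blockBonds_Ps_of_mem G _ hc, blockBonds_Ps_of_mem G A hc]
    have h1 : ∑ b' ∈ G.Bs c, G.Ps A b' = ∑ b' ∈ G.Bs c, ((G.L : ℝ) ^ (G.d - 1))⁻¹ * ∑ b'' ∈ G.Bs c, A b'' :=
      Finset.sum_congr rfl fun b' hb' => blockBonds_Ps_of_mem G A hb'
    rw [h1, Finset.sum_const, hcard, nsmul_eq_mul]
    push_cast
    rw [← mul_assoc, ← mul_assoc, mul_comm (((G.L : ℝ) ^ (G.d - 1))⁻¹) ((G.L : ℝ) ^ (G.d - 1)),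
      mul_inv_cancel₀ hpowne, one_mul]
  · push Not at hb
    rw [blockBonds_Ps_of_not_mem G _ hb, blockBonds_Ps_of_not_mem G A hb]

/-- kernel: on the tori the surface projection `P^s` of (2.18) IS a projection (idempotent; count discharged by `card_Bs`) — with
`Qsstar_Qs` of `BIJ85Sect2SurfaceAverages`, *"Q^{s*}Q^s = LP^s"* outright. [cite: BalabanImbrieJaffe1985, (2.18) p.304] -/
theorem Ps_idem_torus (hj : j + 1 ≤ P.m + P.K) (A : PBond P j → ℝ) (b : PBond P j) :
    (torusBlockBonds P j).Ps ((torusBlockBonds P j).Ps A) b = (torusBlockBonds P j).Ps A b :=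
  blockBonds_Ps_idem (torusBlockBonds P j) (card_Bs hj) A b

end Literature.MathematicalPhysics.QuantumFieldTheory.BalabanImbrieJaffe1984to88.BIJ85Eq219Proof
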